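import Summits.HodgeConjecture.CorCM.Census.QuaternionColumnDistinct
import Summits.HodgeConjecture.CorCM.Census.QuaternionColumnCharacters
import Summits.HodgeConjecture.CorCM.Census.TwoAdicSplitting

/-!
# The quaternion column, VIII-d: the explicit family `qfam` is fibre-independent — tools

COR-CM (cell `pub-hodgecm2`), count-neutral kernel combinatorics by the binder seat b09 (gen 39; lane QUATERNION COLUMN), part VIII-d, on parts
V (`qfam`), VIII-b (`Census/QuaternionColumnDistinct.lean`), VIII-c (`Census/QuaternionColumnCharacters.lean`: `chiA`, `chiB`, `theta_table`,
`par_cycle`) and `Census/TwoAdicSplitting.lean` (`Splitting.linearIndepOn_of_pivot`) used BY NAME.  Three bookkeeping definitions with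
bodies (`thetaVec`, the combined functional vector `(par, θ_{χ_a}, θ_{χ_b})` of an integer vector; `faceI`, the indexed explicit faces; `idxSet`,
their index set) + theorems;
no `decide` beyond closed identities in `𝔽₂`, no certificate, no named fact, no `sorry`.
HONEST FRAMING: `HC_CM` is NOT proved, here or anywhere in the tree; nothing here is a period or a headline.

CONTENT.
* §1 **Elementary operations preserve independence** (`linearIndepOn_of_update_add`): replacing one member `v a` by `v a + w`, `w` in the
  span of the others, does not change linear (in)dependence — used twice to replace the two biarc faces closing the parity cycles by the cycle sums.
* §2 **The combined functional** `thetaVec f = (B ↦ par f B, θ_{χ_a}(f mod 2), θ_{χ_b}(f mod 2))` on `Block ⊕ Bool` kills `rad2` (block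
  parities and stabiliser characters do), so independence of the `thetaVec`-vectors of a family implies its fibre-independence
  (`fibreIndep_of_thetaVec`).
* §3 **The indexed family** `faceI : ℕ × Fin 5 → ℤ[types]` (biarc faces, `f_i`, `c_i`, `f'_j`, `c'_j`) with index set `idxSet`, and
  `↑(qfam n) = faceI '' idxSet` (`coe_qfam_eq_image`); the blocks of the special corners (`blk_specials`, `blk_doubles`).
* §4–§5 the block parity of a face read through `thetaVec` (zero at a block missed by all corners, `±1` at a block met by exactly one), and
  the block inequalities near `T₀` (near types are not biarcs; flips and coincidence types have different potentials).
Part VIII-e runs the pivot argument on `thetaVec ∘ faceI` and concludes the unconditional law.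

## References
* [Pohlmann1968] H. Pohlmann, Algebraic cycles on abelian varieties of complex multiplication type, Ann. of Math. 88 (1968), Thm 1.
-/

namespace Summit.HodgeConjecture.CorCM.Census.QuaternionColumn

open Finset QuaternionGroup
open Summit.HodgeConjecture.CorCM.Prior.AllgGroup.RfwfAllgGroup
open Summit.HodgeConjecture.CorCM.Census.BlockParity
open Summit.HodgeConjecture.CorCM.Census.Coinvariant
open Summit.HodgeConjecture.CorCM.Census.HalfParity
open Summit.HodgeConjecture.CorCM.Census.Splitting
open Summit.HodgeConjecture.CorCM.Census.BaseBlock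
open Summit.HodgeConjecture.CorCM.Census.TwistGeneration

noncomputable section

/-! ## §1 Elementary operations preserve linear independence -/

/-- **Adding a combination of the other members to one member does not create dependence**: if `w ∈ span (v '' (s ∖ {a}))` and the family
`v` updated at `a` to `v a + w` is independent on `s`, so is `v`. [folklore] -/
theorem linearIndepOn_of_update_add {K V ι : Type*} [DivisionRing K] [AddCommGroup V] [Module K V] [DecidableEq ι] (v : ι → V) (s : Set ι)
    (a : ι) (ha : a ∈ s) (w : V) (hw : w ∈ Submodule.span K (v '' (s \ {a})))
    (h : LinearIndepOn K (Function.update v a (v a + w)) s) : LinearIndepOn K v s := by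
  have hs : s = insert a (s \ {a}) := by rw [Set.insert_sdiff_singleton, Set.insert_eq_of_mem ha]
  have hna : a ∉ s \ {a} := fun h => h.2 rfl
  rw [hs] at h ⊢
  rw [linearIndepOn_insert hna] at h ⊢
  have heq : Set.EqOn (Function.update v a (v a + w)) v (s \ {a}) := fun x hx =>
    Function.update_of_ne (fun e : x = a => hna (by rw [e] at hx; exact hx)) _ _
  have himg : Function.update v a (v a + w) '' (s \ {a}) = v '' (s \ {a}) := Set.image_congr heq
  refine ⟨(linearIndepOn_congr heq).mp h.1, fun hmem => h.2 ?_⟩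
  rw [himg, Function.update_self]
  exact Submodule.add_mem _ hmem hw

/-! ## §2 The combined functional vector -/

variable {n : ℕ} [NeZero n]

/-- **The combined functional vector** of an integer vector: block parities and the two stabiliser characters, indexed by `Block ⊕ Bool`. [folklore] -/
def thetaVec (f : CMF (QuaternionGroup n) (c n) →₀ ℤ) : Block (c n) ⊕ Bool → ZMod 2
  | Sum.inl B => par (c n) f B
  | Sum.inr false => theta (c n) chiA (red (c n) f)
  | Sum.inr true => theta (c n) chiB (red (c n) f)

/-- `thetaVec` is additive. [folklore] -/
theorem thetaVec_add (f g : CMF (QuaternionGroup n) (c n) →₀ ℤ) : thetaVec (f + g) = thetaVec f + thetaVec g := by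
  funext x
  rcases x with B | (_ | _) <;> simp only [thetaVec, map_add, Pi.add_apply]

/-- `thetaVec` of a finite sum. [folklore] -/
theorem thetaVec_sum {α : Type*} (s : Finset α) (f : α → (CMF (QuaternionGroup n) (c n) →₀ ℤ)) :
    thetaVec (∑ x ∈ s, f x) = ∑ x ∈ s, thetaVec (f x) := by
  classical
  induction s using Finset.induction_on with
  | empty =>
    rw [sum_empty, sum_empty]
    funext x; rcases x with B | (_ | _) <;> simp only [thetaVec, map_zero, Pi.zero_apply]
  | insert a s has ih => rw [sum_insert has, sum_insert has, thetaVec_add, ih]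

/-- **`thetaVec` factors through the fibre**: it is a linear map on `𝔽₂[types]` killing `rad2`, composed with reduction mod `2`
(`n = 2^m`). [folklore] -/
theorem thetaVec_eq_comp (m : ℕ) (hn : n = 2 ^ m) (h2 : 2 ≤ n) :
    ∃ L : ((CMF (QuaternionGroup n) (c n) →₀ ZMod 2) ⧸ rad2 (c n) c_mul_c) →ₗ[ZMod 2] (Block (c n) ⊕ Bool → ZMod 2),
      ∀ f, thetaVec f = L ((rad2 (c n) c_mul_c).mkQ (red (c n) f)) := by
  have heven : Even n := by
    have hm : m ≠ 0 := by rintro rfl; rw [hn] at h2; norm_num at h2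
    rw [hn]; exact (Nat.even_pow' hm).mpr (by norm_num)
  -- the linear map on `𝔽₂[types]`
  let T : (CMF (QuaternionGroup n) (c n) →₀ ZMod 2) →ₗ[ZMod 2] (Block (c n) ⊕ Bool → ZMod 2) :=
    { toFun := fun v x => match x with
        | Sum.inl B => par2 (c n) v B
        | Sum.inr false => theta (c n) chiA v
        | Sum.inr true => theta (c n) chiB v
      map_add' := fun v w => by funext x; rcases x with B | (_ | _) <;> simp only [map_add, Pi.add_apply]
      map_smul' := fun r v => by funext x; rcases x with B | (_ | _) <;> simp only [map_smul, Pi.smul_apply, RingHom.id_apply] }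
  have hker : rad2 (c n) c_mul_c ≤ LinearMap.ker T := by
    intro v hv
    rw [LinearMap.mem_ker]
    funext x
    rcases x with B | (_ | _)
    · exact congrFun (LinearMap.mem_ker.mp (rad2_le_ker_par2 (c n) c_mul_c hv)) B
    · exact LinearMap.mem_ker.mp (rad2_le_ker_theta (c n) chiA_mul chiA_stab c_mul_c c_comm chiA_c hv)
    · exact LinearMap.mem_ker.mp (rad2_le_ker_theta (c n) (chiB_mul heven) (chiB_stab m hn) c_mul_c c_comm (chiB_c heven) hv)
  refine ⟨(rad2 (c n) c_mul_c).liftQ T hker, fun f => ?_⟩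
  rw [Submodule.mkQ_apply, Submodule.liftQ_apply]
  funext x
  rcases x with B | (_ | _)
  · show par (c n) f B = par2 (c n) (red (c n) f) B; rw [par2_red]
  · rfl
  · rfl

/-- **Independence of the functional vectors implies fibre-independence** (`n = 2^m ≥ 2`). [folklore] -/
theorem fibreIndep_of_thetaVec (m : ℕ) (hn : n = 2 ^ m) (h2 : 2 ≤ n) (s : Set (CMF (QuaternionGroup n) (c n) →₀ ℤ))
    (h : LinearIndepOn (ZMod 2) (fun f => thetaVec f) s) :
    LinearIndepOn (ZMod 2) (fun f : CMF (QuaternionGroup n) (c n) →₀ ℤ => (rad2 (c n) c_mul_c).mkQ (red (c n) f)) s := by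
  obtain ⟨L, hL⟩ := thetaVec_eq_comp m hn h2
  have e : (fun f : CMF (QuaternionGroup n) (c n) →₀ ℤ => thetaVec f) = L ∘ (fun f => (rad2 (c n) c_mul_c).mkQ (red (c n) f)) := by
    funext f; exact hL f
  rw [e] at h
  exact LinearIndepOn.of_comp L h

/-! ## §3 The indexed explicit family and the blocks of its corners -/

/-- **The indexed explicit faces** on `ℕ ⊕ ℕ ⊕ ℕ ⊕ ℕ ⊕ ℕ`: biarc faces `fplus k 0`, rotation chain faces `f_i`, their covers `c_i`, reflection
chain faces `f'_j`, their covers `c'_j`. [folklore] -/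
def faceI (n : ℕ) [NeZero n] : ℕ ⊕ ℕ ⊕ ℕ ⊕ ℕ ⊕ ℕ → (CMF (QuaternionGroup n) (c n) →₀ ℤ)
  | Sum.inl k => fplus (k : ZMod (2 * n)) 0
  | Sum.inr (Sum.inl i) => gface (c n) c_mul_c (barc 0 0) (a (i : ZMod (2 * n))) (xa (-1))
  | Sum.inr (Sum.inr (Sum.inl i)) => gface (c n) c_mul_c (barc 0 0) (a 0) (a ((i : ZMod (2 * n)) + 1))
  | Sum.inr (Sum.inr (Sum.inr (Sum.inl j))) => gface (c n) c_mul_c (barc 0 0) (xa (j : ZMod (2 * n))) (xa (-1))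
  | Sum.inr (Sum.inr (Sum.inr (Sum.inr j))) => gface (c n) c_mul_c (barc 0 0) (a 0) (xa ((j : ZMod (2 * n)) + 1))

/-- The index set of the explicit family. [folklore] -/
def idxSet (n : ℕ) : Set (ℕ ⊕ ℕ ⊕ ℕ ⊕ ℕ ⊕ ℕ)
  | Sum.inl k => k < n
  | Sum.inr (Sum.inl i) => 1 ≤ i ∧ i + 2 ≤ n
  | Sum.inr (Sum.inr (Sum.inl i)) => 1 ≤ i ∧ i + 2 ≤ n
  | Sum.inr (Sum.inr (Sum.inr (Sum.inl j))) => 1 ≤ j ∧ j + 2 ≤ n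
  | Sum.inr (Sum.inr (Sum.inr (Sum.inr j))) => 1 ≤ j ∧ j + 3 ≤ n

/-- **`qfam` is the image of the index set.** [folklore] -/
theorem coe_qfam_eq_image : (↑(qfam n) : Set (CMF (QuaternionGroup n) (c n) →₀ ℤ)) = faceI n '' idxSet n := by
  ext f
  rw [mem_coe, qfam, mem_union, mem_union, mem_union, mem_union, famA, famBf, famBc, famCf, famCc, mem_image, mem_image, mem_image, mem_image,
    mem_image, Set.mem_image]
  constructor
  · rintro ((⟨k, hk, rfl⟩ | ⟨i, hi, rfl⟩ | ⟨i, hi, rfl⟩) | ⟨j, hj, rfl⟩ | ⟨j, hj, rfl⟩)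
    · exact ⟨Sum.inl k, (mem_range.mp hk : k < n), rfl⟩
    · rw [mem_Ico] at hi; exact ⟨Sum.inr (Sum.inl i), (⟨hi.1, by omega⟩ : 1 ≤ i ∧ i + 2 ≤ n), rfl⟩
    · rw [mem_Ico] at hi; exact ⟨Sum.inr (Sum.inr (Sum.inl i)), (⟨hi.1, by omega⟩ : 1 ≤ i ∧ i + 2 ≤ n), rfl⟩
    · rw [mem_Ico] at hj; exact ⟨Sum.inr (Sum.inr (Sum.inr (Sum.inl j))), (⟨hj.1, by omega⟩ : 1 ≤ j ∧ j + 2 ≤ n), rfl⟩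
    · rw [mem_Ico] at hj; exact ⟨Sum.inr (Sum.inr (Sum.inr (Sum.inr j))), (⟨hj.1, by omega⟩ : 1 ≤ j ∧ j + 3 ≤ n), rfl⟩
  · rintro ⟨x, hx, rfl⟩
    rcases x with k | i | i | j | j
    · exact Or.inl (Or.inl ⟨k, mem_range.mpr hx, rfl⟩)
    · exact Or.inl (Or.inr (Or.inl ⟨i, mem_Ico.mpr ⟨hx.1, by have := hx.2; omega⟩, rfl⟩))
    · exact Or.inl (Or.inr (Or.inr ⟨i, mem_Ico.mpr ⟨hx.1, by have := hx.2; omega⟩, rfl⟩))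
    · exact Or.inr (Or.inl ⟨j, mem_Ico.mpr ⟨hx.1, by have := hx.2; omega⟩, rfl⟩)
    · exact Or.inr (Or.inr ⟨j, mem_Ico.mpr ⟨hx.1, by have := hx.2; omega⟩, rfl⟩)

/-- The blocks of two special corners: `blk T₀^{(xa (−1))} = blk (barc 1 0)` and `blk T₀^{(a 0)} = blk (barc 1 0)`; and of the last rotation
flip `blk T₀^{(a (n−1))} = blk (barc (n−1) 0)`. [folklore] -/
theorem blk_specials (h2 : 2 ≤ n) :
    blk (c n) (oflipCM (c n) c_mul_c (xa (-1)) (barc (0 : ZMod (2 * n)) 0)) = blk (c n) (barc ((1 : ℕ) : ZMod (2 * n)) 0) ∧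
      blk (c n) (oflipCM (c n) c_mul_c (a 0) (barc (0 : ZMod (2 * n)) 0)) = blk (c n) (barc ((1 : ℕ) : ZMod (2 * n)) 0) ∧
        blk (c n) (oflipCM (c n) c_mul_c (a (((n - 2 : ℕ) : ZMod (2 * n)) + 1)) (barc (0 : ZMod (2 * n)) 0)) =
          blk (c n) (barc ((n - 1 : ℕ) : ZMod (2 * n)) 0) := by
  refine ⟨?_, by rw [oflipCM_ends.1, Nat.cast_one], ?_⟩
  · rw [oflipCM_ends.2.2.2, show barc (0 : ZMod (2 * n)) (-1) = rt (c n) (a 1) (barc ((1 : ℕ) : ZMod (2 * n)) 0) by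
      rw [rt_a_barc, Nat.cast_one, sub_self, zero_sub], blk_rt]
  · have e : (a (((n - 2 : ℕ) : ZMod (2 * n)) + 1) : QuaternionGroup n) = c n * a (-1) := by
      rw [(c_mul_a _).1, Nat.cast_sub h2, Nat.cast_two]; congr 1; ring
    rw [e, oflipCM_cmul, oflipCM_ends.2.1, show barc (-1 : ZMod (2 * n)) 0 = rt (c n) (xa (((n - 1 : ℕ) : ZMod (2 * n)) + 0 - 1)) (barc ((n - 1 : ℕ) : ZMod (2 * n)) 0) by
      rw [← barc_add_n_left_eq_rt, Nat.cast_sub (by omega), Nat.cast_one]; congr 1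
      linear_combination (-1 : ZMod (2 * n)) * two_n_eq_zero (n := n), blk_rt]

/-- The block of the double corner of `f_i` is `blk C_i`, of `f'_j` (`j ≤ n−3`) is `blk C'_j`, and of `f'_{n−2}` is `blk (barc 2 0)`. [folklore] -/
theorem blk_doubles (h4 : 4 ≤ n) (i : ℕ) :
    blk (c n) (oflipCM (c n) c_mul_c (a (i : ZMod (2 * n))) (oflipCM (c n) c_mul_c (xa (-1)) (barc (0 : ZMod (2 * n)) 0))) =
        blk (c n) (oflipCM (c n) c_mul_c (a 0) (oflipCM (c n) c_mul_c (a ((i : ZMod (2 * n)) + 1)) (barc (0 : ZMod (2 * n)) 0))) ∧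
      blk (c n) (oflipCM (c n) c_mul_c (xa (i : ZMod (2 * n))) (oflipCM (c n) c_mul_c (xa (-1)) (barc (0 : ZMod (2 * n)) 0))) =
        blk (c n) (oflipCM (c n) c_mul_c (a 0) (oflipCM (c n) c_mul_c (xa ((i : ZMod (2 * n)) + 1)) (barc (0 : ZMod (2 * n)) 0))) ∧
      blk (c n) (oflipCM (c n) c_mul_c (a 0) (oflipCM (c n) c_mul_c (xa (((n - 2 : ℕ) : ZMod (2 * n)) + 1)) (barc (0 : ZMod (2 * n)) 0))) =
        blk (c n) (barc ((2 : ℕ) : ZMod (2 * n)) 0) := by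
  refine ⟨by rw [← rt_a_one_oflip_a_zero_a, blk_rt], by rw [← rt_a_one_oflip_a_zero_xa, blk_rt], ?_⟩
  have e : (xa (((n - 2 : ℕ) : ZMod (2 * n)) + 1) : QuaternionGroup n) = c n * xa (-1) := by
    rw [(c_mul_a _).2, Nat.cast_sub (by omega), Nat.cast_two]; congr 1; ring
  rw [e, oflipCM_cmul, oflipCM_ends.2.2.2, oflipCM_a_barc, zero_add,
    show barc (1 : ZMod (2 * n)) (-1) = rt (c n) (a 1) (barc ((2 : ℕ) : ZMod (2 * n)) 0) by rw [rt_a_barc, Nat.cast_two]; norm_num, blk_rt]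

/-! ## §4 The block parities of the indexed faces -/

/-- The block parity of a face at `T₀` read through `thetaVec`. [folklore] -/
theorem thetaVec_inl_gface (t t' : QuaternionGroup n) (B : Block (c n)) :
    thetaVec (gface (c n) c_mul_c (barc 0 0) t t') (Sum.inl B) =
      (if blk (c n) (barc (0 : ZMod (2 * n)) 0) = B then 1 else 0) +
        (if blk (c n) (oflipCM (c n) c_mul_c t (oflipCM (c n) c_mul_c t' (barc 0 0))) = B then 1 else 0) -
        (if blk (c n) (oflipCM (c n) c_mul_c t (barc 0 0)) = B then 1 else 0) -
        (if blk (c n) (oflipCM (c n) c_mul_c t' (barc 0 0)) = B then 1 else 0) := by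
  show par (c n) _ B = _
  rw [par_gface_apply]

/-- The block parity of a biarc face read through `thetaVec`. [folklore] -/
theorem thetaVec_inl_fplus (k : ℕ) (B : Block (c n)) :
    thetaVec (fplus ((k : ℕ) : ZMod (2 * n)) 0) (Sum.inl B) =
      (if B = blk (c n) (barc ((k : ℕ) : ZMod (2 * n)) 0) then 1 else 0) + (if B = blk (c n) (barc ((k + 2 : ℕ) : ZMod (2 * n)) 0) then 1 else 0) := by
  show par (c n) _ B = _
  rw [par_fplus, show ((k : ℕ) : ZMod (2 * n)) + 2 = ((k + 2 : ℕ) : ℕ) by push_cast; ring]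
  simp only [Pi.add_apply, Pi.single_apply]

/-- A face at `T₀` has zero parity at a block met by none of its corners. [folklore] -/
theorem thetaVec_gface_eq_zero {t t' : QuaternionGroup n} {B : Block (c n)} (h1 : blk (c n) (barc (0 : ZMod (2 * n)) 0) ≠ B)
    (h2 : blk (c n) (oflipCM (c n) c_mul_c t (oflipCM (c n) c_mul_c t' (barc 0 0))) ≠ B) (h3 : blk (c n) (oflipCM (c n) c_mul_c t (barc 0 0)) ≠ B)
    (h4 : blk (c n) (oflipCM (c n) c_mul_c t' (barc 0 0)) ≠ B) : thetaVec (gface (c n) c_mul_c (barc 0 0) t t') (Sum.inl B) = 0 := by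
  rw [thetaVec_inl_gface, if_neg h1, if_neg h2, if_neg h3, if_neg h4]; simp

/-- … and parity `−1 ≠ 0` at the block of its first flipped corner when the other corners miss it. [folklore] -/
theorem thetaVec_gface_third {t t' : QuaternionGroup n} (h1 : blk (c n) (barc (0 : ZMod (2 * n)) 0) ≠ blk (c n) (oflipCM (c n) c_mul_c t (barc 0 0)))
    (h2 : blk (c n) (oflipCM (c n) c_mul_c t (oflipCM (c n) c_mul_c t' (barc 0 0))) ≠ blk (c n) (oflipCM (c n) c_mul_c t (barc 0 0)))
    (h4 : blk (c n) (oflipCM (c n) c_mul_c t' (barc 0 0)) ≠ blk (c n) (oflipCM (c n) c_mul_c t (barc 0 0))) :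
    thetaVec (gface (c n) c_mul_c (barc 0 0) t t') (Sum.inl (blk (c n) (oflipCM (c n) c_mul_c t (barc 0 0)))) ≠ 0 := by
  rw [thetaVec_inl_gface, if_neg h1, if_neg h2, if_pos rfl, if_neg h4]; decide

/-- … and parity `1 ≠ 0` at the block of its double corner when the other corners miss it. [folklore] -/
theorem thetaVec_gface_second {t t' : QuaternionGroup n}
    (h1 : blk (c n) (barc (0 : ZMod (2 * n)) 0) ≠ blk (c n) (oflipCM (c n) c_mul_c t (oflipCM (c n) c_mul_c t' (barc 0 0))))
    (h3 : blk (c n) (oflipCM (c n) c_mul_c t (barc 0 0)) ≠ blk (c n) (oflipCM (c n) c_mul_c t (oflipCM (c n) c_mul_c t' (barc 0 0))))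
    (h4 : blk (c n) (oflipCM (c n) c_mul_c t' (barc 0 0)) ≠ blk (c n) (oflipCM (c n) c_mul_c t (oflipCM (c n) c_mul_c t' (barc 0 0)))) :
    thetaVec (gface (c n) c_mul_c (barc 0 0) t t') (Sum.inl (blk (c n) (oflipCM (c n) c_mul_c t (oflipCM (c n) c_mul_c t' (barc 0 0))))) ≠ 0 := by
  rw [thetaVec_inl_gface, if_neg h1, if_pos rfl, if_neg h3, if_neg h4]; decide

/-! ## §5 The block inequalities near `T₀` -/

/-- The blocks of `U_i`, `C_i`, `V_j`, `C'_j` are not biarc blocks; potentials separate flips from coincidence types. [folklore] -/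
theorem near_ne (i : ℕ) (hi : 1 ≤ i) (hi2 : i + 2 ≤ n) (p q : ZMod (2 * n)) :
    blk (c n) (barc p q) ≠ blk (c n) (oflipCM (c n) c_mul_c (a (i : ZMod (2 * n))) (barc (0 : ZMod (2 * n)) 0)) ∧
      blk (c n) (barc p q) ≠ blk (c n) (oflipCM (c n) c_mul_c (a 0) (oflipCM (c n) c_mul_c (a ((i : ZMod (2 * n)) + 1)) (barc (0 : ZMod (2 * n)) 0))) ∧
      blk (c n) (barc p q) ≠ blk (c n) (oflipCM (c n) c_mul_c (xa (i : ZMod (2 * n))) (barc (0 : ZMod (2 * n)) 0)) ∧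
      (i + 3 ≤ n → blk (c n) (barc p q) ≠
        blk (c n) (oflipCM (c n) c_mul_c (a 0) (oflipCM (c n) c_mul_c (xa ((i : ZMod (2 * n)) + 1)) (barc (0 : ZMod (2 * n)) 0)))) :=
  ⟨(blk_ne_barc_of_aPart (aPart_U_ne_arcZ i hi hi2) p q).symm, (blk_ne_barc_of_aPart (aPart_C_ne_arcZ i hi hi2) p q).symm,
    (blk_ne_barc_of_xPart (xPart_V_ne_arcZ i hi hi2) p q).symm, fun hi3 => (blk_ne_barc_of_xPart (xPart_C'_ne_arcZ i hi hi3) p q).symm⟩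

/-- Single flips (potential `≤ 1`) and coincidence types (potential `2`) lie in different blocks. [folklore] -/
theorem flip_ne_coinc (heven : Even n) {s : QuaternionGroup n} (hs : s ∈ (barc (0 : ZMod (2 * n)) 0).1) (i : ℕ) (hi : 1 ≤ i) (hi2 : i + 2 ≤ n) :
    blk (c n) (oflipCM (c n) c_mul_c s (barc 0 0)) ≠
        blk (c n) (oflipCM (c n) c_mul_c (a 0) (oflipCM (c n) c_mul_c (a ((i : ZMod (2 * n)) + 1)) (barc (0 : ZMod (2 * n)) 0))) ∧
      (i + 3 ≤ n → blk (c n) (oflipCM (c n) c_mul_c s (barc 0 0)) ≠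
        blk (c n) (oflipCM (c n) c_mul_c (a 0) (oflipCM (c n) c_mul_c (xa ((i : ZMod (2 * n)) + 1)) (barc (0 : ZMod (2 * n)) 0)))) := by
  have h1 := bpot_oflipCM_base_le_one hs
  refine ⟨blk_ne_of_bpot_lt (c n) (barc 0 0) (by rw [bpot_C heven i hi hi2]; omega), fun hi3 =>
    blk_ne_of_bpot_lt (c n) (barc 0 0) (by rw [bpot_C' heven i hi hi3]; omega)⟩

end

end Summit.HodgeConjecture.CorCM.Census.QuaternionColumn
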